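import Literature.AlgebraicGeometry.HodgeTheory.LefschetzOneOneHeartOfCechIntegral
import Literature.AlgebraicGeometry.HodgeTheory.IntegralCechClass
import HarnessLib

/-!
# The holomorphic exponential cocycle of an integral `(1,1)`-class, with its integer Čech cocycle

Steps 2–5 of the tree's heart of Lefschetz's theorem on `(1,1)`-classes
(`LefschetzOneOneHeartOfCechIntegral`: Weil 1952 / Kostant; Griffiths–Harris pp. 148–149; Voisin I
§3.3.1 read backwards), run with the Čech integrality step WITH THE CLASS of `IntegralCechClass`:
from a real closed `(1,1)`-form `θ` on a chart-convex cover whose class is the complexification of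
the class of an INTEGER singular cocycle `ζ`, one gets holomorphic `G_ij` on `U_i ∩ U_j` with
`G_ij + G_jk − G_ik = −2πi b_ijk`, `b` the integer Čech cocycle of `ζ` (so that `exp G_ij` is a
holomorphic line cocycle "with first Chern class the class of `ζ`", integrally, torsion included).

* `exists_expCocycle_of_intCocycle`.

No named facts; everything is proved (adapted from `exists_isChernForm_of_cechIntegral`).

## References

* P. Griffiths, J. Harris, *Principles of Algebraic Geometry* (1978), pp. 139–141, 148–149.
  [GriffithsHarris1978]
* C. Voisin, *Hodge Theory and Complex Algebraic Geometry I* (2002), §3.3.1, Thm. 7.10, Thm. 11.30.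
  [VoisinHodgeI2002]
-/

noncomputable section

open scoped Manifold ContDiff Topology
open Set Filter Function
open Literature.Geometry.Kaehler hiding cechδ_apply cechd_apply cechδ cechd cechSet mem_cechSet_iff
open Literature.Geometry.Manifold
open Literature.NumberTheory.Transcendental
open Literature.Algebra.Homology
open Literature.AlgebraicTopology.SingularHomology hiding cechSet mem_cechSet_iff cechSet_subset_comp
  cechSet_subset_apply cechSet_cons

namespace Literature.AlgebraicGeometry.HodgeTheory

section Core

variable {E : Type} [NormedAddCommGroup E] [NormedSpace ℂ E] [FiniteDimensional ℂ E]
  {M : Type} [TopologicalSpace M] [ChartedSpace E M] [IsManifold 𝓘(ℂ, E) ω M]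
  [IsManifold 𝓘(ℝ, E) ∞ M] [T2Space M] [CompactSpace M]

-- adapted from Literature/AlgebraicGeometry/HodgeTheory/LefschetzOneOneHeartOfCechIntegral.lean
-- (`exists_isChernForm_of_cechIntegral`, steps 2–5), with the refined Čech integrality step
/-- **The exponential cocycle of an integral `(1,1)`-class, with its integer Čech cocycle.** Let `𝒰`
be a chart-convex cover of the compact complex manifold `M`, `θ` a smooth closed REAL `(1,1)`-form and
`ζ` an integer-valued singular `2`-cocycle whose complex class is the class of `θ` under the
complexified integration isomorphism. Then there are functions `G_ij` holomorphic on `U_i ∩ U_j` with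
`G_ij + G_jk − G_ik = −2πi b_ijk` on `U_i ∩ U_j ∩ U_k`, where `b` is the INTEGER Čech cocycle of `ζ` on
`𝒰` (with its collating zigzag `Y`): steps 2–5 of the heart of Lefschetz `(1,1)`
(`exists_isChernForm_of_cechIntegral`: local potentials, pluriharmonic conjugates `F_ij`, the de Rham
zigzag, `G_ij = F_ij + 2πi Re a_ij`) run with the Čech integrality step WITH the class
(`exists_sub_cechδ_eq_intCech_of_complexify_eq_π`). So `exp G` presents a holomorphic line bundle
whose integer Čech cocycle is that of `ζ`. [cite: GriffithsHarris1978, pp. 148–149]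
[cite: VoisinHodgeI2002, §3.3.1 and Thm. 7.10] -/
theorem exists_expCocycle_of_intCocycle {ι : Type} (𝒰 : ChartConvexCover E M ι)
    {θ : MForm 𝓘(ℝ, E) M ℂ 2} (hs : IsSmoothForm θ) (hc : IsClosedForm θ) (h11 : IsOfType 1 1 θ)
    (hr : θ.conj = θ) (ζ : SingularSimplex M 2 → ℤ)
    (hζ : ∀ σ : SingularSimplex M 3, ∑ i : Fin 4, (-1 : ℤ) ^ (i : ℕ) * ζ (σ.face i) = 0)
    (hθζ : (integrationDeRhamIsoFamily E).complexify M 2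
        (complexDeRhamCohomology.mk E M 2 ⟨θ, mem_cclosedSmoothForms hs hc⟩) =
      singularCohomology.π ℂ ℂ M 2 (complexCocycle ζ hζ)) :
    ∃ (G : ι → ι → M → ℂ) (b : ι → ι → ι → ℤ) (Y : ∀ p q, CechCochain ℤ IntCoeff 𝒰.U p q),
      (∀ i j, MDifferentiableOn 𝓘(ℂ, E) 𝓘(ℂ, ℂ) (G i j) (𝒰.U i ∩ 𝒰.U j)) ∧
      (∀ i j k, ∀ x ∈ 𝒰.U i ∩ 𝒰.U j ∩ 𝒰.U k,
        G i j x + G j k x - G i k x = 2 * Real.pi * Complex.I * ((-b i j k : ℤ) : ℂ)) ∧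
      (∀ i j k l, (𝒰.U i ∩ 𝒰.U j ∩ 𝒰.U k ∩ 𝒰.U l).Nonempty → b j k l - b i k l + b i j l - b i j k = 0) ∧
      Y ∈ ADoubleComplex.Tn ℤ (X := CechCochain ℤ IntCoeff 𝒰.U) 1 ∧
      ADoubleComplex.single 0 2 ((cechSingularRow ℤ IntCoeff 𝒰.U).ε 2
          (toSmall ℤ IntCoeff 𝒰.U (fun _ ↦ subset_univ _) 2 (intCochain ζ))) -
        ADoubleComplex.single 2 0 (cechZeroIncl ℤ IntCoeff 𝒰.U 2 (constCechCocycle 𝒰.U ℤ intCoeffHom b)) =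
      (cechSingular ℤ IntCoeff 𝒰.U).totalD Y := by
  -- the sets of the cover and their small intersections are empty or chart-convex
  have hdesc : ∀ {m : ℕ} (J : Fin (m + 1) → ι),
      IsEmptyOrChartConvex (E := E) (Literature.Geometry.Kaehler.cechSet 𝒰.U J) := by
    intro m J
    rcases (Literature.Geometry.Kaehler.cechSet 𝒰.U J).eq_empty_or_nonempty with h | h
    · exact Or.inl h
    · obtain ⟨p, C, hC, hCc, hCt, hJ⟩ := 𝒰.exists_chart m J h
      refine Or.inr ⟨p, C, hC, hCc, ?_, hJ⟩
      rw [extChartAt_self]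
      exact hCt
  have hU1 : ∀ i, IsEmptyOrChartConvex (E := E) (𝒰.U i) := fun i ↦ by
    simpa only [cechSet_const_fin_one] using hdesc (fun _ : Fin 1 ↦ i)
  have hU2 : ∀ i j, IsEmptyOrChartConvex (E := E) (𝒰.U i ∩ 𝒰.U j) := fun i j ↦ by
    simpa only [cechSet_vec_two] using hdesc ![i, j]
  have hU3 : ∀ i j k, IsEmptyOrChartConvex (E := E) (𝒰.U i ∩ 𝒰.U j ∩ 𝒰.U k) := fun i j k ↦ by
    simpa only [cechSet_vec_three] using hdesc ![i, j, k]
  have hUo : ∀ i, IsOpen (𝒰.U i) := 𝒰.isOpen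
  have hUo2 : ∀ i j, IsOpen (𝒰.U i ∩ 𝒰.U j) := fun i j ↦ (hUo i).inter (hUo j)
  have hUo3 : ∀ i j k, IsOpen (𝒰.U i ∩ 𝒰.U j ∩ 𝒰.U k) := fun i j k ↦ (hUo2 i j).inter (hUo k)
  ---- Step 2: local potentials `θ = (1/4π) d((dφ_i) ∘ J)` on `U_i`
  choose φ hφs hφ using fun i ↦ exists_potential_on (hU1 i) hs hc h11 hr
  -- the complexified potentials as `0`-forms, their smoothness near the points of `U_i`
  set φC : ι → M → ℂ := fun i z ↦ (φ i z : ℂ) with hφC_def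
  have hφCs : ∀ i, ∀ x ∈ 𝒰.U i, ContMDiffAt 𝓘(ℝ, E) 𝓘(ℝ, ℂ) ∞ (φC i) x := fun i x hx ↦
    Complex.ofRealCLM.contDiff.comp_contMDiffAt (hφs i x hx)
  have hφ0 : ∀ i, ∀ x ∈ 𝒰.U i, ∀ᶠ z in 𝓝 x, (MForm.ofFun 𝓘(ℝ, E) (φC i)).SmoothAt z :=
    fun i x hx ↦ Filter.eventually_of_mem ((hUo i).mem_nhds hx) fun z hz ↦
      MForm.smoothAt_ofFun_of_contMDiffAt (hφCs i z hz)
  ---- Step 3: holomorphic `F_ij` with `2 Re F_ij = φ_i − φ_j` on `U_i ∩ U_j`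
  have hu : ∀ i j, ∀ x ∈ 𝒰.U i ∩ 𝒰.U j,
      ContMDiffAt 𝓘(ℝ, E) 𝓘(ℝ, ℝ) ∞ (fun z ↦ (φ i z - φ j z) / 2) x := fun i j x hx ↦
    ((hφs i x hx.1).sub (hφs j x hx.2)).div_const 2
  have hudd : ∀ i j, ∀ x ∈ 𝒰.U i ∩ 𝒰.U j,
      mextDeriv (mextDeriv (MForm.ofFun 𝓘(ℝ, E) fun z ↦ (((φ i z - φ j z) / 2 : ℝ) : ℂ))).compJ x
        = 0 := by
    intro i j x hx
    -- `(φ_i − φ_j)/2` as the combination `½ φ_iC − ½ φ_jC` of `0`-forms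
    have hform : (MForm.ofFun 𝓘(ℝ, E) fun z ↦ (((φ i z - φ j z) / 2 : ℝ) : ℂ)) =
        (1 / 2 : ℝ) • (MForm.ofFun 𝓘(ℝ, E) (φC i) + (-1 : ℝ) • MForm.ofFun 𝓘(ℝ, E) (φC j)) := by
      funext z
      ext v
      simp only [MForm.ofFun_apply, hφC_def, Pi.smul_apply, Pi.add_apply,
        ContinuousAlternatingMap.smul_apply, ContinuousAlternatingMap.add_apply, Complex.real_smul]
      push_cast
      ring
    rw [hform, mextDeriv_smul, MForm.compJ_smul, mextDeriv_smul, Pi.smul_apply]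
    -- `d` of the sum at `x`: both summands are smooth near `x`
    have h1 : ∀ᶠ z in 𝓝 x, (MForm.ofFun 𝓘(ℝ, E) (φC i)).SmoothAt z := hφ0 i x hx.1
    have h2 : ∀ᶠ z in 𝓝 x, ((-1 : ℝ) • MForm.ofFun 𝓘(ℝ, E) (φC j)).SmoothAt z :=
      (hφ0 j x hx.2).mono fun z hz ↦ hz.smul _
    have hsum : ∀ᶠ z in 𝓝 x,
        mextDeriv (MForm.ofFun 𝓘(ℝ, E) (φC i) + (-1 : ℝ) • MForm.ofFun 𝓘(ℝ, E) (φC j)) z =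
          (mextDeriv (MForm.ofFun 𝓘(ℝ, E) (φC i)) +
            (-1 : ℝ) • mextDeriv (MForm.ofFun 𝓘(ℝ, E) (φC j))) z := by
      filter_upwards [h1.eventually_nhds, h2.eventually_nhds] with z hz1 hz2
      rw [mextDeriv_add_apply hz1.self_of_nhds hz2.self_of_nhds, mextDeriv_smul, Pi.add_apply,
        Pi.smul_apply]
    have hsumJ : ∀ᶠ z in 𝓝 x,
        (mextDeriv (MForm.ofFun 𝓘(ℝ, E) (φC i) + (-1 : ℝ) • MForm.ofFun 𝓘(ℝ, E) (φC j))).compJ z =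
          ((mextDeriv (MForm.ofFun 𝓘(ℝ, E) (φC i))).compJ +
            (-1 : ℝ) • (mextDeriv (MForm.ofFun 𝓘(ℝ, E) (φC j))).compJ) z := by
      filter_upwards [hsum] with z hz
      ext v
      rw [MForm.compJ_apply, hz]
      simp only [Pi.add_apply, Pi.smul_apply, ContinuousAlternatingMap.add_apply,
        ContinuousAlternatingMap.smul_apply, MForm.compJ_apply]
    have hd1 : ((mextDeriv (MForm.ofFun 𝓘(ℝ, E) (φC i))).compJ).SmoothAt x :=
      (MForm.SmoothAt.mextDeriv h1).compJ
    have hd2 : ((-1 : ℝ) • (mextDeriv (MForm.ofFun 𝓘(ℝ, E) (φC j))).compJ).SmoothAt x :=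
      ((MForm.SmoothAt.mextDeriv (hφ0 j x hx.2)).compJ).smul _
    rw [mextDeriv_congr_of_eventuallyEq hsumJ, mextDeriv_add_apply hd1 hd2, mextDeriv_smul,
      Pi.smul_apply]
    -- both `d((dφ) ∘ J)` are `4π θ x`
    have key : ∀ l, x ∈ 𝒰.U l →
        mextDeriv (mextDeriv (MForm.ofFun 𝓘(ℝ, E) (φC l))).compJ x = (4 * Real.pi) • θ x := by
      intro l hl
      have h := hφ l x hl
      rw [Pi.smul_apply] at h
      rw [← h, smul_smul, show (4 * Real.pi) * (1 / (4 * Real.pi)) = 1 by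
        field_simp, one_smul]
    rw [key i hx.1, key j hx.2]
    simp
  choose F hF hFre using fun i j ↦ exists_conjugate_on (hU2 i j) (hu i j) (hudd i j)
  have hFre2 : ∀ i j, ∀ x ∈ 𝒰.U i ∩ 𝒰.U j, 2 * (F i j x).re = φ i x - φ j x := by
    intro i j x hx
    rw [hFre i j x hx]
    ring
  have hFs : ∀ i j, ∀ x ∈ 𝒰.U i ∩ 𝒰.U j, ContMDiffAt 𝓘(ℝ, E) 𝓘(ℝ, ℂ) ∞ (F i j) x :=
    fun i j x hx ↦ contMDiffAt_real_of_mdifferentiableOn_complex (hF i j) (hUo2 i j) hx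
  -- the defects are constant on the triple intersections
  have hdefect : ∀ i j k, ∃ cc : ℂ, ∀ x ∈ 𝒰.U i ∩ 𝒰.U j ∩ 𝒰.U k,
      F i j x + F j k x - F i k x = cc := by
    intro i j k
    have hs1 : 𝒰.U i ∩ 𝒰.U j ∩ 𝒰.U k ⊆ 𝒰.U i ∩ 𝒰.U j := fun y hy ↦ ⟨hy.1.1, hy.1.2⟩
    have hs2 : 𝒰.U i ∩ 𝒰.U j ∩ 𝒰.U k ⊆ 𝒰.U j ∩ 𝒰.U k := fun y hy ↦ ⟨hy.1.2, hy.2⟩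
    have hs3 : 𝒰.U i ∩ 𝒰.U j ∩ 𝒰.U k ⊆ 𝒰.U i ∩ 𝒰.U k := fun y hy ↦ ⟨hy.1.1, hy.2⟩
    refine exists_const_on (hU3 i j k) (F := fun y ↦ F i j y + F j k y - F i k y) ?_ ?_
    · intro x hx
      exact (((hF i j).mono hs1 x hx).add ((hF j k).mono hs2 x hx)).sub ((hF i k).mono hs3 x hx)
    · intro x hx
      simp only [Complex.sub_re, Complex.add_re, hFre i j x ⟨hx.1.1, hx.1.2⟩,
        hFre j k x ⟨hx.1.2, hx.2⟩, hFre i k x ⟨hx.1.1, hx.2⟩]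
      ring
  choose cc hcc using hdefect
  ---- Step 4: the de Rham zigzag `α_i = (1/4π)(dφ_i) ∘ J`, `f_ij = −Im F_ij / 2π`, `c` real
  set α : ι → MForm 𝓘(ℝ, E) M ℂ 1 := fun i ↦
    ((1 / (4 * Real.pi)) • (mextDeriv (MForm.ofFun 𝓘(ℝ, E) (φC i))).compJ).restr (𝒰.U i)
    with hα_def
  have hαmem : ∀ i, α i ∈ smoothFormsOn 𝓘(ℝ, E) ℂ (𝒰.U i) 1 := fun i ↦
    ⟨fun x hx ↦ (MForm.smoothAt_restr_iff (hUo i) _ hx).2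
      ((MForm.SmoothAt.mextDeriv (hφ0 i x hx)).compJ.smul _),
      fun x hx ↦ MForm.restr_apply_of_notMem _ hx⟩
  have hdα : ∀ i, ∀ x ∈ 𝒰.U i, mextDeriv (α i) x = θ x := by
    intro i x hx
    rw [hα_def, mextDeriv_restr_apply (hUo i) _ hx, mextDeriv_smul]
    exact hφ i x hx
  set f : ι → ι → M → ℂ := fun i j z ↦ ((-(1 / (2 * Real.pi)) * (F i j z).im : ℝ) : ℂ)
    with hf_def
  have hfform : ∀ i j, MForm.ofFun 𝓘(ℝ, E) (f i j) =
      (-(1 / (2 * Real.pi))) • MForm.ofFun 𝓘(ℝ, E) (fun z ↦ (((F i j z).im : ℝ) : ℂ)) := by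
    intro i j
    funext z
    ext v
    simp only [MForm.ofFun_apply, hf_def, Pi.smul_apply, ContinuousAlternatingMap.smul_apply,
      Complex.real_smul]
    push_cast
    ring
  have hfs : ∀ i j, ∀ x ∈ 𝒰.U i ∩ 𝒰.U j, (MForm.ofFun 𝓘(ℝ, E) (f i j)).SmoothAt x := by
    intro i j x hx
    rw [hfform]
    exact (MForm.smoothAt_ofFun_of_contMDiffAt
      ((Complex.ofRealCLM.comp Complex.imCLM).contDiff.comp_contMDiffAt (hFs i j x hx))).smul _
  have hdf : ∀ i j, ∀ x ∈ 𝒰.U i ∩ 𝒰.U j,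
      mextDeriv (MForm.ofFun 𝓘(ℝ, E) (f i j)) x = α i x - α j x := by
    intro i j x hx
    -- `d(φ_i − φ_j) = 2 d(Re F_ij)` near `x`
    have hReform : ∀ᶠ z in 𝓝 x, (MForm.ofFun 𝓘(ℝ, E) (φC i) + (-1 : ℝ) • MForm.ofFun 𝓘(ℝ, E) (φC j)) z =
        ((2 : ℝ) • MForm.ofFun 𝓘(ℝ, E) (fun z ↦ (((F i j z).re : ℝ) : ℂ))) z := by
      filter_upwards [(hUo2 i j).mem_nhds hx] with z hz
      ext v
      simp only [Pi.add_apply, Pi.smul_apply, ContinuousAlternatingMap.add_apply,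
        ContinuousAlternatingMap.smul_apply, MForm.ofFun_apply, hφC_def, Complex.real_smul]
      have h := hFre2 i j z hz
      push_cast
      rw [show (2 : ℂ) * ((F i j z).re : ℂ) = ((2 * (F i j z).re : ℝ) : ℂ) by push_cast; ring, h]
      push_cast
      ring
    have h1 : ∀ᶠ z in 𝓝 x, (MForm.ofFun 𝓘(ℝ, E) (φC i)).SmoothAt z := hφ0 i x hx.1
    have h2 : ∀ᶠ z in 𝓝 x, ((-1 : ℝ) • MForm.ofFun 𝓘(ℝ, E) (φC j)).SmoothAt z :=
      (hφ0 j x hx.2).mono fun z hz ↦ hz.smul _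
    have hdd : mextDeriv (MForm.ofFun 𝓘(ℝ, E) (φC i)) x - mextDeriv (MForm.ofFun 𝓘(ℝ, E) (φC j)) x =
        (2 : ℝ) • mextDeriv (MForm.ofFun 𝓘(ℝ, E) (fun z ↦ (((F i j z).re : ℝ) : ℂ))) x := by
      have h := mextDeriv_congr_of_eventuallyEq hReform
      rw [mextDeriv_add_apply h1.self_of_nhds h2.self_of_nhds, mextDeriv_smul, mextDeriv_smul,
        Pi.smul_apply, Pi.smul_apply, neg_one_smul, ← sub_eq_add_neg] at h
      exact h
    ext v
    have hαi : α i x = ((1 / (4 * Real.pi)) • (mextDeriv (MForm.ofFun 𝓘(ℝ, E) (φC i))).compJ) x := by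
      simp only [hα_def, MForm.restr_apply_of_mem _ hx.1]
    have hαj : α j x = ((1 / (4 * Real.pi)) • (mextDeriv (MForm.ofFun 𝓘(ℝ, E) (φC j))).compJ) x := by
      simp only [hα_def, MForm.restr_apply_of_mem _ hx.2]
    have hddv := DFunLike.congr_fun hdd (fun l ↦ tangentJ E x (v l))
    simp only [ContinuousAlternatingMap.sub_apply, ContinuousAlternatingMap.smul_apply,
      Complex.real_smul] at hddv
    rw [ContinuousAlternatingMap.sub_apply, hαi, hαj, hfform, mextDeriv_smul, Pi.smul_apply,
      ContinuousAlternatingMap.smul_apply, mextDeriv_ofFun_im_eq_neg_re_compJ (hF i j) (hUo2 i j) hx]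
    simp only [Pi.smul_apply, ContinuousAlternatingMap.smul_apply, MForm.compJ_apply,
      Complex.real_smul]
    push_cast at hddv ⊢
    linear_combination (-(1 / (4 * (Real.pi : ℂ)))) * hddv
  set c : ι → ι → ι → ℂ := fun i j k ↦ ((-(1 / (2 * Real.pi)) * (cc i j k).im : ℝ) : ℂ)
    with hc_def
  have hcrel : ∀ i j k, ∀ x ∈ 𝒰.U i ∩ 𝒰.U j ∩ 𝒰.U k, f i j x + f j k x - f i k x = c i j k := by
    intro i j k x hx
    have h := congrArg Complex.im (hcc i j k x hx)
    simp only [Complex.sub_im, Complex.add_im] at h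
    simp only [hf_def, hc_def, ← h]
    push_cast
    ring
  ---- (Z) with the class: `c − δa = b`, `b` the integer Čech cocycle of `ζ`
  obtain ⟨b, Y, hb4, hY, hbY⟩ := exists_intCech_of_intCocycle 𝒰 ζ hζ
  obtain ⟨a, han⟩ := exists_sub_cechδ_eq_intCech_of_complexify_eq_π 𝒰 θ (mem_cclosedSmoothForms hs hc) ζ hζ hθζ
    hb4 hY hbY α hαmem hdα f hfs hdf c hcrel
  -- real parts: `c` is real, so `c − δ(Re a) = n` as well
  have hanr : ∀ i j k, (𝒰.U i ∩ 𝒰.U j ∩ 𝒰.U k).Nonempty →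
      (c i j k).re - ((a i j).re + (a j k).re - (a i k).re) = b i j k := by
    intro i j k hne
    have h := congrArg Complex.re (han i j k hne)
    simpa only [Complex.sub_re, Complex.add_re, Complex.intCast_re] using h
  have hcre : ∀ i j k, (c i j k).re = -(1 / (2 * Real.pi)) * (cc i j k).im := by
    intro i j k
    simp only [hc_def, Complex.ofReal_re]
  -- the defects `cc` are imaginary: `Re cc = 0` on nonempty triples
  have hccre : ∀ i j k, ∀ x ∈ 𝒰.U i ∩ 𝒰.U j ∩ 𝒰.U k, (cc i j k).re = 0 := by
    intro i j k x hx
    have h := congrArg Complex.re (hcc i j k x hx)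
    simp only [Complex.sub_re, Complex.add_re, hFre i j x ⟨hx.1.1, hx.1.2⟩,
      hFre j k x ⟨hx.1.2, hx.2⟩, hFre i k x ⟨hx.1.1, hx.2⟩] at h
    linarith
  ---- Step 5: the holomorphic cocycle `G_ij = F_ij + 2πi Re(a_ij)` and the packaging
  set G : ι → ι → M → ℂ := fun i j z ↦ F i j z + 2 * Real.pi * Complex.I * ((a i j).re : ℂ)
    with hG_def
  have hG : ∀ i j, MDifferentiableOn 𝓘(ℂ, E) 𝓘(ℂ, ℂ) (G i j) (𝒰.U i ∩ 𝒰.U j) := fun i j x hx ↦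
    (hF i j x hx).add mdifferentiableWithinAt_const
  have hGcoc : ∀ i j k, ∀ x ∈ 𝒰.U i ∩ 𝒰.U j ∩ 𝒰.U k,
      G i j x + G j k x - G i k x = 2 * Real.pi * Complex.I * ((-b i j k : ℤ) : ℂ) := by
    intro i j k x hx
    have h1 := hcc i j k x hx
    have h2 := hanr i j k ⟨x, hx⟩
    have h3 := hccre i j k x hx
    -- `cc = i Im cc` and `c.re − δ(Re a) = b`, `c.re = −Im cc / 2π`
    have hccI : cc i j k = ((cc i j k).im : ℂ) * Complex.I := by
      apply Complex.ext <;> simp [h3]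
    have hsum : G i j x + G j k x - G i k x =
        cc i j k + 2 * Real.pi * Complex.I * (((a i j).re + (a j k).re - (a i k).re : ℝ) : ℂ) := by
      simp only [hG_def, ← h1]
      push_cast
      ring
    rw [hsum, hccI]
    have h4 : ((a i j).re + (a j k).re - (a i k).re : ℝ) = (c i j k).re - b i j k := by linarith
    rw [h4, hcre]
    have hπ : (Real.pi : ℂ) ≠ 0 := Complex.ofReal_ne_zero.2 Real.pi_ne_zero
    push_cast
    field_simp
    ring
  exact ⟨G, b, Y, hG, hGcoc, hb4, hY, hbY⟩

end Core

end Literature.AlgebraicGeometry.HodgeTheory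

end
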